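import Literature.Analysis.FluidPDE.StokesMollified
import Literature.Analysis.FluidPDE.PressureGradientInterior
import Literature.Analysis.FluidPDE.SmoothParabolicHolder
import Literature.Analysis.FluidPDE.MixedNormMollification
import Literature.Analysis.FunctionSpaces.Mollification
import HarnessLib

/-!
# Local regularity of the Stokes system: the parabolic Hölder bound, discharged

Analysis/FluidPDE proofs file (theorems only, no definitions, no named facts) discharging the
named fact `Literature.Analysis.FluidPDE.StokesLocalHolderBound`
(`FluidPDE/SereginLocalStokesRegularity`; G. Seregin, *Lecture notes on regularity theory for
the Navier–Stokes equations* (2014), §4.6, Prop. 6.7 (case `s = m`) followed by Prop. 6.8: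
a distributional solution of `∂ₜu - Δu + ∇p = f`, `div u = 0` in `Q(z,R)` with
`u, ∇u, p, f ∈ L_{s,n}(Q(z,R))`, `1 < n ≤ 2`, `μ = 2 - 2/n - 3/s > 0`, is parabolic-Hölder of
exponent `μ` on `Q(z,r)` with `[u]_μ ≤ C (‖f‖ + ‖u‖ + ‖∇u‖ + ‖p‖)_{s,n,Q(z,R)}`).

The printed route goes through the full `W^{2,1}_{s,n}` estimate of Prop. 6.7 (Solonnikov's
coercive estimates for the Stokes system, vendored as the named fact `StokesLocalW21Estimate`,
`FluidPDE/SereginLocalStokesW21`, from which the fact also follows by the proved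
`StokesLocalHolderBound_of_stokesLocalW21Estimate`). The Hölder bound itself, however, only needs
the **pressure half** of Prop. 6.7 — the elliptic estimate for `Δp = div f` (proof of Prop. 6.7,
p. 59) — combined with the heat-potential argument behind Prop. 6.8, because the cut-off velocity
is the heat potential of `φ(f - ∇p) + (∂ₜφ - Δφ)u - 2∇φ·∇u ∈ L_{s,n}`. This file carries out that
proof, for the **regularised** solution and with one passage to the limit:

1. `u_j = k_j ⋆ 𝟙_Q u`, `p_j`, `f_j` (space–time mollification by normalised bumps of radius
   `ε_j → 0`, `FluidPDE/SpaceTimeMollifier`) solve the Stokes system classically on the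
   `ε_j`-interior of `Q(z,R)` (`FluidPDE/StokesMollified`), which contains the shifted cylinder
   `Q(z_j, R₁)`, `z_j = (t₀ - ε_j, x₀)`; and `D u_j = k_j ⋆ 𝟙_Q ∇u` there;
2. the mixed norms of `u_j`, `Du_j`, `p_j`, `f_j` on `Q(z_j, ·)` are bounded by those of the data
   on `Q(z,R)` (`FluidPDE/MixedNormMollification`, Minkowski's integral inequality);
3. `‖∇p_j‖_{s,n,Q(z_j,r₂)} ≤ C₄ (‖p_j‖ + ‖f_j‖)_{s,n,Q(z_j,R₁)}` (`FluidPDE/PressureGradientInterior`: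
   Green's representation at a fixed scale and the tree's proved Calderón–Zygmund bound of
   Stein, for `Δp_j = div f_j`);
4. `FluidPDE/SmoothParabolicHolder` applied to `u_j` with `∂ₜu_j - Δu_j = f_j - ∇p_j` gives the
   parabolic Hölder bound for `u_j` on `Q(z_j, r₁)` with constant `C₅ (1 + C₄) N`, `N` the sum of
   the four input norms, uniformly in `j`;
5. `u_j → u` a.e. (Lebesgue differentiation, Mathlib), and an equi-Hölder sequence converging on
   a set of full measure converges everywhere on `Q(z,r)` to a Hölder function
   (`exists_holder_limit_of_ae_tendsto`), which is the representative `V`.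

* `StokesLocalHolderBound_holds : StokesLocalHolderBound`.

## References

* G. Seregin, *Lecture notes on regularity theory for the Navier–Stokes equations*, World
  Scientific (2014), §4.6, Prop. 6.7–6.8, pp. 58–60. [`Seregin2014`]
* G. Seregin, V. Šverák, Comm. PDE 34 (2009) = arXiv:0804.1803, §4 p. 11 (the instance
  `(s,n) = (6,3/2)`). [`SereginSverak2009`]
* L. C. Evans, *Partial Differential Equations*, 2nd ed. (2010), App. C.4 Thm. 7 (mollifiers).
  [`Evans2010`]
-/

noncomputable section

open MeasureTheory TopologicalSpace Set Function Metric Filter InnerProductSpace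
open scoped InnerProductSpace RealInnerProductSpace ENNReal NNReal Topology Laplacian ContDiff
  Convolution

namespace Literature.Analysis.FluidPDE

open Literature.Analysis.FunctionSpaces

/-! ### Tools -/

section Tools

variable {F' : Type*} [NormedAddCommGroup F'] [NormedSpace ℝ F']

/-- **Mixed norms of the mollified zero extension.** For a normalised bump kernel `k = φ.normed`
on `ℝ × ℝ³` and a field `X` a.e.-strongly measurable on the cylinder `Q(z,R)`, the mixed norm of
`k ⋆ 𝟙_{Q(z,R)} X` on any cylinder is at most `‖X‖_{s,n,Q(z,R)}` (`1 ≤ s`, `1 ≤ n`; Minkowski's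
integral inequality, `mixedNorm_stMollify_indicator_le`, after replacing `X` by a strongly
measurable modification, which changes neither the mollification nor the norm). [folklore] -/
theorem mixedNorm_stMollify_zeroExt_le {s n : ℝ} (hs : 1 ≤ s) (hn : 1 ≤ n)
    (φ : ContDiffBump ((0 : ℝ × EuclideanSpace ℝ (Fin 3))))
    (z z' : ℝ × EuclideanSpace ℝ (Fin 3)) (R R' : ℝ) {X : ℝ → EuclideanSpace ℝ (Fin 3) → F'}
    (hX : AEStronglyMeasurable (uncurry X) (volume.restrict (parabolicCylinder R z))) :
    mixedNorm s n z' R' (uncurry (stMollify (φ.normed volume)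
      (zeroExt (parabolicCylinderOpens R z) X))) ≤ mixedNorm s n z R (uncurry X) := by
  haveI : (volume : Measure (ℝ × EuclideanSpace ℝ (Fin 3))).IsAddHaarMeasure :=
    Measure.prod.instIsAddHaarMeasure _ _
  have hs0 : 0 ≤ s := by linarith
  have hn0 : 0 < n := by linarith
  have hQm : MeasurableSet (parabolicCylinder R z) := (isOpen_parabolicCylinder R z).measurableSet
  -- a strongly measurable modification
  set X' : ℝ × EuclideanSpace ℝ (Fin 3) → F' := hX.mk (uncurry X) with hX'
  have hX'm : StronglyMeasurable X' := hX.stronglyMeasurable_mk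
  have hae : uncurry X =ᵐ[volume.restrict (parabolicCylinder R z)] X' := hX.ae_eq_mk
  have hind : zeroExt (parabolicCylinderOpens R z) X =ᵐ[volume]
      (parabolicCylinder R z).indicator X' := by
    have h1 := (ae_restrict_iff' hQm).1 hae
    filter_upwards [h1] with w hw
    by_cases hwQ : w ∈ parabolicCylinder R z
    · rw [zeroExt_of_mem X (show w ∈ ((parabolicCylinderOpens R z : Opens _) : Set _) from hwQ),
        indicator_of_mem hwQ]
      exact hw hwQ
    · rw [zeroExt_of_not_mem X (show w ∉ ((parabolicCylinderOpens R z : Opens _) : Set _) from hwQ),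
        indicator_of_notMem hwQ]
  rw [stMollify_congr_ae (φ.normed volume) hind]
  calc mixedNorm s n z' R' (uncurry (stMollify (φ.normed volume)
        ((parabolicCylinder R z).indicator X')))
      ≤ (∫⁻ w, ‖φ.normed volume w‖ₑ) * mixedNorm s n z R X' :=
        mixedNorm_stMollify_indicator_le hs hn (φ.contDiff_normed (n := 1)).continuous.measurable
          hX'm z z' R R'
    _ = mixedNorm s n z R X' := by rw [lintegral_enorm_normed_haar, one_mul]
    _ ≤ mixedNorm s n z R (uncurry X) :=
        mixedNorm_mono_ae hs0 hn0 (hae.mono fun w hw => by rw [hw])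

/-- **Interior geometry of the mollification.** If `2ε ≤ R² - R₁²` and `ε ≤ R - R₁`,
then for every point `(t, x)` of the shifted cylinder `Q((t₀ - ε, x₀), R₁)` the closed ball
`closedBall (t, x) ε` of `ℝ × ℝ³` (sup metric) lies in `Q((t₀, x₀), R)`. [folklore] -/
theorem closedBall_subset_parabolicCylinder_of_mem {ε R R₁ : ℝ}
    (h1 : 2 * ε ≤ R ^ 2 - R₁ ^ 2) (h2 : ε ≤ R - R₁) {t₀ : ℝ} {x₀ : EuclideanSpace ℝ (Fin 3)}
    {w : ℝ × EuclideanSpace ℝ (Fin 3)}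
    (hw : w ∈ parabolicCylinder R₁ ((t₀ - ε, x₀) : ℝ × EuclideanSpace ℝ (Fin 3))) :
    closedBall w ε ⊆ parabolicCylinder R ((t₀, x₀) : ℝ × EuclideanSpace ℝ (Fin 3)) := by
  intro y hy
  rw [mem_parabolicCylinder] at hw ⊢
  dsimp only at hw
  rw [mem_closedBall, Prod.dist_eq, max_le_iff, Real.dist_eq, abs_le] at hy
  obtain ⟨⟨hy1, hy1'⟩, hy2⟩ := hy
  refine ⟨⟨by linarith [hw.1.1], by linarith [hw.1.2]⟩, ?_⟩
  calc dist y.2 x₀ ≤ dist y.2 w.2 + dist w.2 x₀ := dist_triangle _ _ _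
    _ < ε + R₁ := add_lt_add_of_le_of_lt hy2 hw.2
    _ ≤ R := by linarith

/-- **An equi-Hölder sequence converging almost everywhere converges on all of the open set to a
Hölder function.** Let `S ⊆ ℝ × ℝ³` be open, `u_j → U` a.e. (in `ℝ³`), and suppose that for all
`z_a, z_b ∈ S`, eventually in `j`, `‖u_j(z_a) - u_j(z_b)‖ ≤ L δ₂(z_a, z_b)^μ` (`δ₂` the parabolic
distance, `L ≥ 0`, `μ > 0`). Then there is `V` with `V = U` a.e. on `S` and
`‖V(z_a) - V(z_b)‖ ≤ L δ₂(z_a, z_b)^μ` for all `z_a, z_b ∈ S` (the convergence set is dense; the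
sequence is Cauchy at every point of `S` by the three-`ε` argument; `V` is the pointwise limit).
[folklore] -/
theorem exists_holder_limit_of_ae_tendsto {S : Set (ℝ × EuclideanSpace ℝ (Fin 3))} (hS : IsOpen S)
    {useq : ℕ → ℝ × EuclideanSpace ℝ (Fin 3) → EuclideanSpace ℝ (Fin 3)}
    {U : ℝ × EuclideanSpace ℝ (Fin 3) → EuclideanSpace ℝ (Fin 3)}
    (hae : ∀ᵐ w ∂(volume : Measure (ℝ × EuclideanSpace ℝ (Fin 3))),
      Tendsto (fun j => useq j w) atTop (𝓝 (U w)))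
    {L μ : ℝ} (hL : 0 ≤ L) (hμ : 0 < μ)
    (hH : ∀ za ∈ S, ∀ zb ∈ S, ∀ᶠ j in atTop,
      ‖useq j za - useq j zb‖ ≤ L * parabolicDist za zb ^ μ) :
    ∃ V : ℝ × EuclideanSpace ℝ (Fin 3) → EuclideanSpace ℝ (Fin 3),
      (∀ᵐ w ∂(volume : Measure (ℝ × EuclideanSpace ℝ (Fin 3))), w ∈ S → V w = U w) ∧
      ∀ za ∈ S, ∀ zb ∈ S, ‖V za - V zb‖ ≤ L * parabolicDist za zb ^ μ := by
  set A : Set (ℝ × EuclideanSpace ℝ (Fin 3)) :=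
    {w | Tendsto (fun j => useq j w) atTop (𝓝 (U w))} with hA
  have hAc : volume Aᶜ = 0 := by
    rw [ae_iff] at hae
    simpa only [hA, compl_setOf] using hae
  -- density of the convergence set, for the parabolic distance
  have hdense : ∀ w ∈ S, ∀ δ : ℝ, 0 < δ → ∃ w' ∈ S, w' ∈ A ∧ parabolicDist w w' < δ := by
    intro w hw δ hδ
    set δ₁ : ℝ := min (δ / 4) ((δ / 2) ^ 2) with hδ₁
    have hδ₁0 : 0 < δ₁ := lt_min (by positivity) (by positivity)
    have hδ₁4 : δ₁ ≤ δ / 4 := min_le_left _ _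
    have hδ₁sq : Real.sqrt δ₁ ≤ δ / 2 := by
      rw [Real.sqrt_le_left (by positivity)]
      exact min_le_right _ _
    set O : Set (ℝ × EuclideanSpace ℝ (Fin 3)) := S ∩ ball w δ₁ with hO
    have hOo : IsOpen O := hS.inter isOpen_ball
    have hOne : O.Nonempty := ⟨w, hw, mem_ball_self hδ₁0⟩
    have hOpos : 0 < volume O := hOo.measure_pos volume hOne
    have hOA : (O ∩ A).Nonempty := by
      apply nonempty_of_measure_ne_zero (μ := volume)
      rw [measure_inter_conull hAc]
      exact hOpos.ne'
    obtain ⟨w', ⟨hw'S, hw'b⟩, hw'A⟩ := hOA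
    refine ⟨w', hw'S, hw'A, ?_⟩
    rw [mem_ball, Prod.dist_eq, max_lt_iff, Real.dist_eq] at hw'b
    have e1 : |w.1 - w'.1| < δ₁ := by rw [abs_sub_comm]; exact hw'b.1
    have e2 : ‖w.2 - w'.2‖ < δ₁ := by rw [← dist_eq_norm, dist_comm]; exact hw'b.2
    have e3 : Real.sqrt |w.1 - w'.1| ≤ Real.sqrt δ₁ := Real.sqrt_le_sqrt e1.le
    calc parabolicDist w w' = Real.sqrt |w.1 - w'.1| + ‖w.2 - w'.2‖ := rfl
      _ < δ / 2 + δ / 4 := add_lt_add_of_le_of_lt (e3.trans hδ₁sq) (e2.trans_le hδ₁4)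
      _ ≤ δ := by linarith
  -- the sequence is Cauchy at every point of `S`
  have hcauchy : ∀ w ∈ S, CauchySeq fun j => useq j w := by
    intro w hw
    rw [Metric.cauchySeq_iff]
    intro η hη
    -- a parabolic radius `δ` with `L δ^μ < η / 3`
    set δ : ℝ := (η / (3 * (L + 1))) ^ (1 / μ) with hδ
    have hq : 0 < η / (3 * (L + 1)) := by positivity
    have hδ0 : 0 < δ := Real.rpow_pos_of_pos hq _
    have hδμ : δ ^ μ = η / (3 * (L + 1)) := by
      rw [hδ, ← Real.rpow_mul hq.le, one_div_mul_cancel hμ.ne', Real.rpow_one]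
    have hLδ : L * δ ^ μ < η / 3 := by
      rw [hδμ]
      have hL1 : 0 < L + 1 := by linarith
      calc L * (η / (3 * (L + 1))) < (L + 1) * (η / (3 * (L + 1))) := by gcongr; linarith
        _ = η * (L + 1) / (3 * (L + 1)) := by ring
        _ = η / 3 := mul_div_mul_right η 3 hL1.ne'
    obtain ⟨w', hw'S, hw'A, hd⟩ := hdense w hw δ hδ0
    have hbound : L * parabolicDist w w' ^ μ < η / 3 := by
      refine lt_of_le_of_lt ?_ hLδ
      exact mul_le_mul_of_nonneg_left
        (Real.rpow_le_rpow (parabolicDist_nonneg _ _) hd.le hμ.le) hL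
    obtain ⟨N₁, hN₁⟩ := eventually_atTop.1 (hH w hw w' hw'S)
    have h2 : CauchySeq fun j => useq j w' := hw'A.cauchySeq
    rw [Metric.cauchySeq_iff] at h2
    obtain ⟨N₂, hN₂⟩ := h2 (η / 3) (by positivity)
    refine ⟨max N₁ N₂, fun m hm k hk => ?_⟩
    have hm₁ : N₁ ≤ m := le_of_max_le_left hm
    have hk₁ : N₁ ≤ k := le_of_max_le_left hk
    have hm₂ : N₂ ≤ m := le_of_max_le_right hm
    have hk₂ : N₂ ≤ k := le_of_max_le_right hk
    calc dist (useq m w) (useq k w)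
        ≤ dist (useq m w) (useq m w') + dist (useq m w') (useq k w') + dist (useq k w') (useq k w) :=
          dist_triangle4 _ _ _ _
      _ < η / 3 + η / 3 + η / 3 := by
          refine add_lt_add (add_lt_add_of_le_of_lt ?_ (hN₂ m hm₂ k hk₂)) ?_
          · rw [dist_eq_norm]
            exact ((hN₁ m hm₁).trans hbound.le)
          · rw [dist_comm, dist_eq_norm]
            exact lt_of_le_of_lt (hN₁ k hk₁) hbound
      _ = η := by ring
  -- the pointwise limit
  set V : ℝ × EuclideanSpace ℝ (Fin 3) → EuclideanSpace ℝ (Fin 3) := fun w =>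
    limUnder atTop fun j => useq j w with hV
  have hVlim : ∀ w ∈ S, Tendsto (fun j => useq j w) atTop (𝓝 (V w)) := fun w hw =>
    tendsto_nhds_limUnder (cauchySeq_tendsto_of_complete (hcauchy w hw))
  refine ⟨V, ?_, fun za hza zb hzb => ?_⟩
  · filter_upwards [hae] with w hw hwS
    exact tendsto_nhds_unique (hVlim w hwS) hw
  · have ht : Tendsto (fun j => ‖useq j za - useq j zb‖) atTop (𝓝 ‖V za - V zb‖) :=
      ((hVlim za hza).sub (hVlim zb hzb)).norm
    exact le_of_tendsto ht (hH za hza zb hzb)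

end Tools

/-! ### The uniform bound for one level of regularisation -/

section Level

/-- Arithmetic of the constants: from `e ≤ C₅ S D` and `S ≤ (1 + C₄) M` to
`e ≤ (C₅ (1 + C₄)) M D`. [folklore] -/
theorem edist_bound_of_le_mul {C₅ C₄ : ℝ≥0} {e S M D : ℝ≥0∞} (h₁ : e ≤ (C₅ : ℝ≥0∞) * S * D)
    (h₂ : S ≤ (1 + C₄ : ℝ≥0∞) * M) : e ≤ ((C₅ * (1 + C₄) : ℝ≥0) : ℝ≥0∞) * M * D := by
  refine h₁.trans ?_
  push_cast
  calc (C₅ : ℝ≥0∞) * S * D ≤ (C₅ : ℝ≥0∞) * ((1 + C₄ : ℝ≥0∞) * M) * D := by gcongr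
    _ = (C₅ : ℝ≥0∞) * (1 + C₄) * M * D := by ring

/-- Arithmetic of the three input norms: `x₁ ≤ b`, `x₂ ≤ c`, `x₃ ≤ a + C (d + a)` give
`x₁ + x₂ + x₃ ≤ (1 + C) (a + b + c + d)`. [folklore] -/
theorem sum_three_le_of_bounds {a b c d x₁ x₂ x₃ C : ℝ≥0∞} (h₁ : x₁ ≤ b) (h₂ : x₂ ≤ c)
    (h₃ : x₃ ≤ a + C * (d + a)) : x₁ + x₂ + x₃ ≤ (1 + C) * (a + b + c + d) := by
  calc x₁ + x₂ + x₃ ≤ b + c + (a + C * (d + a)) := add_le_add (add_le_add h₁ h₂) h₃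
    _ ≤ b + c + (a + C * (d + a)) + (d + C * (b + c)) := le_self_add
    _ = (1 + C) * (a + b + c + d) := by ring

set_option maxHeartbeats 400000 in
/-- **The uniform parabolic Hölder bound for one level of regularisation.** Let `(u, p)` be a
distributional Stokes solution with force `f` on `Q(z,R)`, `G` a weak spatial gradient of `u`,
all four integrable on the cylinder with finite mixed norms, and let `k = φ₀.normed` be a
normalised bump of radius `ε = φ₀.rOut` with `2ε ≤ R² - R₁²`, `ε ≤ R - R₁` (radii
`0 < r₂ < R₁`, any `r₁`, `R`). Given the constants `C₅` of `exists_holder_bound_smooth_heat`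
(radii `r₁ < r₂`) and `C₄` of `mixedNorm_fderiv_pressure_le` (radii `r₂ < R₁`) at the spatial
centre `x₀ = z.2`, the regularised velocity `k ⋆ 𝟙_Q u` satisfies on the shifted cylinder
`Q((t₀ - ε, x₀), r₁)` the parabolic Hölder bound with constant `C₅ (1 + C₄) N`,
`N = (‖f‖ + ‖u‖ + ‖∇u‖ + ‖p‖)_{s,n,Q(z,R)}` (steps 1–4 of the module docstring: the mollified
equations on the `ε`-interior, Minkowski, the pressure-gradient estimate, the smooth Hölder
estimate with `∂ₜu_ε - Δu_ε = f_ε - ∇p_ε`). [cite: Seregin2014, §4.6 Prop. 6.7–6.8 (pp. 58–60)] -/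
theorem mollified_holder_bound {s n : ℝ} (hs : 1 < s) (hn : 1 < n) {r₁ r₂ R₁ R : ℝ}
    (hr₂0 : 0 < r₂) (hr₂R₁ : r₂ < R₁) (z : ℝ × EuclideanSpace ℝ (Fin 3))
    {C₅ C₄ : ℝ≥0}
    (hC₅ : ∀ (v : ℝ → EuclideanSpace ℝ (Fin 3) → EuclideanSpace ℝ (Fin 3)) (t₁ : ℝ),
      ContDiff ℝ ∞ (uncurry v) →
      mixedNorm s n ((t₁, z.2) : ℝ × EuclideanSpace ℝ (Fin 3)) r₂ (uncurry v) +
          mixedNorm s n ((t₁, z.2) : ℝ × EuclideanSpace ℝ (Fin 3)) r₂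
            (uncurry fun t x => fderiv ℝ (v t) x) +
          mixedNorm s n ((t₁, z.2) : ℝ × EuclideanSpace ℝ (Fin 3)) r₂
            (uncurry fun t x => timeDeriv v t x - (Δ (v t)) x) < ⊤ →
      ∀ za ∈ parabolicCylinder r₁ ((t₁, z.2) : ℝ × EuclideanSpace ℝ (Fin 3)),
        ∀ zb ∈ parabolicCylinder r₁ ((t₁, z.2) : ℝ × EuclideanSpace ℝ (Fin 3)),
          edist (uncurry v za) (uncurry v zb) ≤
            C₅ * (mixedNorm s n ((t₁, z.2) : ℝ × EuclideanSpace ℝ (Fin 3)) r₂ (uncurry v) +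
                mixedNorm s n ((t₁, z.2) : ℝ × EuclideanSpace ℝ (Fin 3)) r₂
                  (uncurry fun t x => fderiv ℝ (v t) x) +
                mixedNorm s n ((t₁, z.2) : ℝ × EuclideanSpace ℝ (Fin 3)) r₂
                  (uncurry fun t x => timeDeriv v t x - (Δ (v t)) x)) *
              ENNReal.ofReal ((dist za.2 zb.2 + |za.1 - zb.1| ^ (1 / 2 : ℝ)) ^
                (2 - 2 / n - 3 / s)))
    (hC₄ : ∀ (P : ℝ → EuclideanSpace ℝ (Fin 3) → ℝ)
      (F : ℝ → EuclideanSpace ℝ (Fin 3) → EuclideanSpace ℝ (Fin 3)) (t₁ : ℝ),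
      Continuous (uncurry P) → Continuous (uncurry F) →
      (∀ t, ContDiff ℝ ∞ (P t)) → (∀ t, ContDiff ℝ ∞ (F t)) →
      (∀ t ∈ Ioo (t₁ - r₂ ^ 2) t₁, ∀ x ∈ ball z.2 R₁,
        (Δ (P t)) x = VectorCalculus.divergence (F t) x) →
      mixedNorm s n ((t₁, z.2) : ℝ × EuclideanSpace ℝ (Fin 3)) r₂
          (uncurry fun t x => fderiv ℝ (P t) x) ≤
        C₄ * (mixedNorm s n ((t₁, z.2) : ℝ × EuclideanSpace ℝ (Fin 3)) R₁ (uncurry P) +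
          mixedNorm s n ((t₁, z.2) : ℝ × EuclideanSpace ℝ (Fin 3)) R₁ (uncurry F)))
    {u f : ℝ → EuclideanSpace ℝ (Fin 3) → EuclideanSpace ℝ (Fin 3)}
    {p : ℝ → EuclideanSpace ℝ (Fin 3) → ℝ}
    {G : ℝ → EuclideanSpace ℝ (Fin 3) → EuclideanSpace ℝ (Fin 3) →L[ℝ] EuclideanSpace ℝ (Fin 3)}
    (hsol : IsDistributionalStokesSolutionOn (parabolicCylinderOpens R z) f u p)
    (hG : HasWeakSpatialGradientOn (parabolicCylinderOpens R z) u G)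
    (hu_int : IntegrableOn (uncurry u) (parabolicCylinder R z) volume)
    (hp_int : IntegrableOn (uncurry p) (parabolicCylinder R z) volume)
    (hf_int : IntegrableOn (uncurry f) (parabolicCylinder R z) volume)
    (hG_int : IntegrableOn (uncurry G) (parabolicCylinder R z) volume)
    (hN : mixedNorm s n z R (uncurry f) + mixedNorm s n z R (uncurry u) +
      mixedNorm s n z R (uncurry G) + mixedNorm s n z R (uncurry p) < ⊤)
    (φ₀ : ContDiffBump ((0 : ℝ × EuclideanSpace ℝ (Fin 3))))
    (h1 : 2 * φ₀.rOut ≤ R ^ 2 - R₁ ^ 2) (h2 : φ₀.rOut ≤ R - R₁) :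
    ∀ za ∈ parabolicCylinder r₁ ((z.1 - φ₀.rOut, z.2) : ℝ × EuclideanSpace ℝ (Fin 3)),
      ∀ zb ∈ parabolicCylinder r₁ ((z.1 - φ₀.rOut, z.2) : ℝ × EuclideanSpace ℝ (Fin 3)),
        edist (uncurry (stMollify (φ₀.normed volume) (zeroExt (parabolicCylinderOpens R z) u)) za)
            (uncurry (stMollify (φ₀.normed volume) (zeroExt (parabolicCylinderOpens R z) u)) zb) ≤
          ((C₅ * (1 + C₄) : ℝ≥0) : ℝ≥0∞) *
              (mixedNorm s n z R (uncurry f) + mixedNorm s n z R (uncurry u) +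
                mixedNorm s n z R (uncurry G) + mixedNorm s n z R (uncurry p)) *
            ENNReal.ofReal ((dist za.2 zb.2 + |za.1 - zb.1| ^ (1 / 2 : ℝ)) ^
              (2 - 2 / n - 3 / s)) := by
  intro za hza zb hzb
  haveI : (volume : Measure (ℝ × EuclideanSpace ℝ (Fin 3))).IsAddHaarMeasure :=
    Measure.prod.instIsAddHaarMeasure _ _
  have hs1 : (1 : ℝ) ≤ s := hs.le
  have hn1 : (1 : ℝ) ≤ n := hn.le
  have hs0 : (0 : ℝ) < s := by linarith
  have hn0 : (0 : ℝ) < n := by linarith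
  -- notation
  set Q : Opens (ℝ × EuclideanSpace ℝ (Fin 3)) := parabolicCylinderOpens R z with hQdef
  have hQset : ((Q : Opens (ℝ × EuclideanSpace ℝ (Fin 3))) : Set (ℝ × EuclideanSpace ℝ (Fin 3))) =
      parabolicCylinder R z := rfl
  set ε : ℝ := φ₀.rOut with hεdef
  have hεpos : 0 < ε := φ₀.rOut_pos
  set k : ℝ × EuclideanSpace ℝ (Fin 3) → ℝ := φ₀.normed volume with hkdef
  have hk : ContDiff ℝ ∞ k := φ₀.contDiff_normed
  have hkr : ∀ w, w ∉ closedBall (0 : ℝ × EuclideanSpace ℝ (Fin 3)) ε → k w = 0 := by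
    intro w hw
    have hw' : w ∉ Function.support k := by
      rw [hkdef, φ₀.support_normed_eq]
      exact fun h => hw (ball_subset_closedBall h)
    exact notMem_support.1 hw'
  have hkc : HasCompactSupport k := φ₀.hasCompactSupport_normed
  set zε : ℝ × EuclideanSpace ℝ (Fin 3) := (z.1 - ε, z.2) with hzε
  -- measurability of the data on `Q(z,R)`
  have hu_m : AEStronglyMeasurable (uncurry u) (volume.restrict (parabolicCylinder R z)) :=
    hsol.1.aestronglyMeasurable
  have hp_m : AEStronglyMeasurable (uncurry p) (volume.restrict (parabolicCylinder R z)) :=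
    hsol.2.1.aestronglyMeasurable
  have hf_m : AEStronglyMeasurable (uncurry f) (volume.restrict (parabolicCylinder R z)) :=
    hsol.2.2.1.aestronglyMeasurable
  have hG_m : AEStronglyMeasurable (uncurry G) (volume.restrict (parabolicCylinder R z)) :=
    hG.locallyIntegrableOn_grad.aestronglyMeasurable
  -- the regularised fields
  set U : ℝ → EuclideanSpace ℝ (Fin 3) → EuclideanSpace ℝ (Fin 3) := stMollify k (zeroExt Q u)
    with hU
  set P : ℝ → EuclideanSpace ℝ (Fin 3) → ℝ := stMollify k (zeroExt Q p) with hP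
  set Fm : ℝ → EuclideanSpace ℝ (Fin 3) → EuclideanSpace ℝ (Fin 3) := stMollify k (zeroExt Q f)
    with hFm
  set Gm : ℝ → EuclideanSpace ℝ (Fin 3) →
      (EuclideanSpace ℝ (Fin 3) →L[ℝ] EuclideanSpace ℝ (Fin 3)) := stMollify k (zeroExt Q G) with hGm
  have huE : LocallyIntegrable (zeroExt Q u) volume := locallyIntegrable_zeroExt hu_int
  have hpE : LocallyIntegrable (zeroExt Q p) volume := locallyIntegrable_zeroExt hp_int
  have hfE : LocallyIntegrable (zeroExt Q f) volume := locallyIntegrable_zeroExt hf_int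
  have hU_sm : ContDiff ℝ ∞ (uncurry U) := contDiff_uncurry_stMollify hk hkc huE
  have hP_sm : ContDiff ℝ ∞ (uncurry P) := contDiff_uncurry_stMollify hk hkc hpE
  have hF_sm : ContDiff ℝ ∞ (uncurry Fm) := contDiff_uncurry_stMollify hk hkc hfE
  ------------------------------------------------------------------
  -- Step 1: the equations on `Q(zε, R₁)`
  ------------------------------------------------------------------
  have hint : ∀ w ∈ parabolicCylinder R₁ zε,
      closedBall w ε ⊆ (Q : Set (ℝ × EuclideanSpace ℝ (Fin 3))) := by
    intro w hw
    rw [hQset]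
    have hw' : w ∈ parabolicCylinder R₁ ((z.1 - ε, z.2) : ℝ × EuclideanSpace ℝ (Fin 3)) := hw
    have := closedBall_subset_parabolicCylinder_of_mem h1 h2 hw'
    simpa only [Prod.mk.eta] using this
  have heqs : ∀ w : ℝ × EuclideanSpace ℝ (Fin 3),
      closedBall w ε ⊆ (Q : Set (ℝ × EuclideanSpace ℝ (Fin 3))) →
      (timeDeriv U w.1 w.2 - (Δ (U w.1)) w.2 = Fm w.1 w.2 - gradient (P w.1) w.2) ∧
      ((Δ (P w.1)) w.2 = VectorCalculus.divergence (Fm w.1) w.2) ∧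
      fderiv ℝ (U w.1) w.2 = Gm w.1 w.2 := by
    intro w hw
    have hw' : closedBall ((w.1, w.2) : ℝ × EuclideanSpace ℝ (Fin 3)) ε ⊆ Q := by
      simpa only [Prod.mk.eta] using hw
    refine ⟨?_, ?_, ?_⟩
    · have h := hsol.mollified_momentum_vec hu_int hp_int hf_int hk hkr hw'
      simp only [hU, hP, hFm]
      rw [← h]
      abel
    · exact hsol.laplacian_mollified_pressure hp_int hf_int hk hkr hw'
    · exact hG.fderiv_mollified hu_int hG_int hk hkr hw'
  ------------------------------------------------------------------
  -- Step 2: mixed norms of the regularised fields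
  ------------------------------------------------------------------
  have hNu : ∀ (z' : ℝ × EuclideanSpace ℝ (Fin 3)) (R' : ℝ),
      mixedNorm s n z' R' (uncurry U) ≤ mixedNorm s n z R (uncurry u) := fun z' R' =>
    mixedNorm_stMollify_zeroExt_le hs1 hn1 φ₀ z z' R R' hu_m
  have hNp : ∀ (z' : ℝ × EuclideanSpace ℝ (Fin 3)) (R' : ℝ),
      mixedNorm s n z' R' (uncurry P) ≤ mixedNorm s n z R (uncurry p) := fun z' R' =>
    mixedNorm_stMollify_zeroExt_le hs1 hn1 φ₀ z z' R R' hp_m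
  have hNf : ∀ (z' : ℝ × EuclideanSpace ℝ (Fin 3)) (R' : ℝ),
      mixedNorm s n z' R' (uncurry Fm) ≤ mixedNorm s n z R (uncurry f) := fun z' R' =>
    mixedNorm_stMollify_zeroExt_le hs1 hn1 φ₀ z z' R R' hf_m
  have hNG : ∀ (z' : ℝ × EuclideanSpace ℝ (Fin 3)) (R' : ℝ),
      mixedNorm s n z' R' (uncurry Gm) ≤ mixedNorm s n z R (uncurry G) := fun z' R' =>
    mixedNorm_stMollify_zeroExt_le hs1 hn1 φ₀ z z' R R' hG_m
  ------------------------------------------------------------------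
  -- Step 3–4: the three input norms of the smooth estimate
  ------------------------------------------------------------------
  have hQ₂ : parabolicCylinder r₂ zε ⊆ parabolicCylinder R₁ zε :=
    prod_mono (Ioo_subset_Ioo_left (by nlinarith)) (ball_subset_ball hr₂R₁.le)
  -- `‖DU‖ ≤ ‖G‖` (`DU = Gm` on the cylinder)
  have hS₂le : mixedNorm s n zε r₂ (uncurry fun t x => fderiv ℝ (U t) x) ≤
      mixedNorm s n z R (uncurry G) := by
    refine le_trans (mixedNorm_mono (F' := uncurry Gm) hs0.le hn0 ?_) (hNG zε r₂)
    rintro ⟨t, x⟩ hw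
    have e := (heqs (t, x) (hint _ (hQ₂ hw))).2.2
    dsimp only at e
    simp only [uncurry_apply_pair]
    rw [e]
  -- `‖∇P‖ ≤ C₄ (‖p‖ + ‖f‖)` on `Q(zε, r₂)`
  have hPj : mixedNorm s n zε r₂ (uncurry fun t x => fderiv ℝ (P t) x) ≤
      C₄ * (mixedNorm s n z R (uncurry p) + mixedNorm s n z R (uncurry f)) := by
    have h := hC₄ P Fm zε.1 hP_sm.continuous hF_sm.continuous
      (fun t => hP_sm.comp (contDiff_prodMk_right t))
      (fun t => hF_sm.comp (contDiff_prodMk_right t)) (fun t ht x hx => ?_)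
    · refine h.trans ?_
      exact mul_le_mul' le_rfl (add_le_add (hNp _ _) (hNf _ _))
    · have hw : ((t, x) : ℝ × EuclideanSpace ℝ (Fin 3)) ∈ parabolicCylinder R₁ zε := by
        rw [mem_parabolicCylinder]
        refine ⟨⟨?_, ht.2⟩, hx⟩
        have : zε.1 - R₁ ^ 2 ≤ zε.1 - r₂ ^ 2 := by nlinarith
        exact lt_of_le_of_lt this ht.1
      exact (heqs (t, x) (hint _ hw)).2.1
  -- `‖∂ₜU - ΔU‖ ≤ ‖f‖ + C₄ (‖p‖ + ‖f‖)` (`∂ₜU - ΔU = Fm - ∇P` on the cylinder)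
  have hS₃le : mixedNorm s n zε r₂ (uncurry fun t x => timeDeriv U t x - (Δ (U t)) x) ≤
      mixedNorm s n z R (uncurry f) +
        C₄ * (mixedNorm s n z R (uncurry p) + mixedNorm s n z R (uncurry f)) := by
    have hm1 : Measurable fun w : ℝ × EuclideanSpace ℝ (Fin 3) => ‖Fm w.1 w.2‖ₑ := by
      have hc : Continuous fun w : ℝ × EuclideanSpace ℝ (Fin 3) => ‖Fm w.1 w.2‖ :=
        hF_sm.continuous.norm
      simpa only [ofReal_norm] using hc.measurable.ennreal_ofReal
    have hm2 : Measurable fun w : ℝ × EuclideanSpace ℝ (Fin 3) => ‖fderiv ℝ (P w.1) w.2‖ₑ := by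
      have hc : Continuous fun w : ℝ × EuclideanSpace ℝ (Fin 3) => ‖fderiv ℝ (P w.1) w.2‖ :=
        (continuous_fderiv_slice_of_uncurry hP_sm).norm
      simpa only [ofReal_norm] using hc.measurable.ennreal_ofReal
    have hpt : ∀ w ∈ parabolicCylinder r₂ zε,
        ‖(uncurry fun t x => timeDeriv U t x - (Δ (U t)) x) w‖ₑ ≤
          ‖Fm w.1 w.2‖ₑ + ‖fderiv ℝ (P w.1) w.2‖ₑ := by
      rintro ⟨t, x⟩ hw
      have e := (heqs (t, x) (hint _ (hQ₂ hw))).1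
      dsimp only at e ⊢
      simp only [uncurry_apply_pair]
      rw [e]
      have en : ‖gradient (P t) x‖ₑ = ‖fderiv ℝ (P t) x‖ₑ := by
        rw [← ofReal_norm (gradient (P t) x), ← ofReal_norm (fderiv ℝ (P t) x), gradient,
          LinearIsometryEquiv.norm_map]
      exact (enorm_sub_le).trans (le_of_eq (by rw [en]))
    have hstep := mixedNorm_le_add_of_enorm_le hs1 hn1 zε r₂ hm1 hm2 hpt
    have e1 : mixedNorm s n zε r₂ (fun w : ℝ × EuclideanSpace ℝ (Fin 3) => ‖Fm w.1 w.2‖ₑ) =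
        mixedNorm s n zε r₂ (uncurry Fm) := mixedNorm_enorm s n zε r₂ (uncurry Fm)
    have e2 : mixedNorm s n zε r₂ (fun w : ℝ × EuclideanSpace ℝ (Fin 3) => ‖fderiv ℝ (P w.1) w.2‖ₑ) =
        mixedNorm s n zε r₂ (uncurry fun t x => fderiv ℝ (P t) x) :=
      mixedNorm_enorm s n zε r₂ (uncurry fun t x => fderiv ℝ (P t) x)
    rw [e1, e2] at hstep
    exact hstep.trans (add_le_add (hNf zε r₂) hPj)
  -- the total
  have hSle : mixedNorm s n zε r₂ (uncurry U) +
      mixedNorm s n zε r₂ (uncurry fun t x => fderiv ℝ (U t) x) +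
      mixedNorm s n zε r₂ (uncurry fun t x => timeDeriv U t x - (Δ (U t)) x) ≤
      (1 + C₄ : ℝ≥0∞) * (mixedNorm s n z R (uncurry f) + mixedNorm s n z R (uncurry u) +
        mixedNorm s n z R (uncurry G) + mixedNorm s n z R (uncurry p)) :=
    sum_three_le_of_bounds (hNu zε r₂) hS₂le hS₃le
  have hSfin : mixedNorm s n zε r₂ (uncurry U) +
      mixedNorm s n zε r₂ (uncurry fun t x => fderiv ℝ (U t) x) +
      mixedNorm s n zε r₂ (uncurry fun t x => timeDeriv U t x - (Δ (U t)) x) < ⊤ :=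
    lt_of_le_of_lt hSle (ENNReal.mul_lt_top (by simp) hN)
  -- apply the smooth estimate at the centre `zε = (z.1 - ε, z.2)`
  have key := hC₅ U zε.1 hU_sm hSfin za hza zb hzb
  exact edist_bound_of_le_mul key hSle

end Level

/-! ### The discharge -/

section Main

set_option maxHeartbeats 400000 in
/-- **Local regularity of the Stokes system: the parabolic Hölder bound, discharged** (Seregin
2014, §4.6, Prop. 6.7 (case `s = m`) with Prop. 6.8, pp. 58–60; the instance `(s,n) = (6, 3/2)` is
Seregin–Šverák 2009, §4 p. 11): see the module docstring for the route (mollification, the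
pressure half of Prop. 6.7 for `Δp = div f`, the heat-potential Hölder estimate, and an a.e.
limit). [cite: Seregin2014, §4.6 Prop. 6.7 (4.6.4) (case s = m) and Prop. 6.8 (pp. 58–60)] -/
theorem StokesLocalHolderBound_holds : StokesLocalHolderBound := by
  intro z r R s n hr hrR hs hn hn2 hμ
  haveI : (volume : Measure (ℝ × EuclideanSpace ℝ (Fin 3))).IsAddHaarMeasure :=
    Measure.prod.instIsAddHaarMeasure _ _
  -- exponents
  have hμ1 : 2 - 2 / n - 3 / s < 1 := by
    have h1 : 1 ≤ 2 / n := by rw [le_div_iff₀ (by linarith)]; linarith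
    have h2 : 0 < 3 / s := by positivity
    linarith
  have hn1 : (1 : ℝ) ≤ n := hn.le
  have hR : 0 < R := hr.trans hrR
  -- radii `r < r₁ < r₂ < R₁ < R`
  set r₁ : ℝ := (3 * r + R) / 4 with hr₁
  set r₂ : ℝ := (r + R) / 2 with hr₂
  set R₁ : ℝ := (r + 3 * R) / 4 with hR₁
  have hrr₁ : r < r₁ := by rw [hr₁]; linarith
  have hr₁₂ : r₁ < r₂ := by rw [hr₁, hr₂]; linarith
  have hr₂R₁ : r₂ < R₁ := by rw [hr₂, hR₁]; linarith
  have hR₁R : R₁ < R := by rw [hR₁]; linarith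
  have hr₁0 : 0 < r₁ := hr.trans hrr₁
  have hr₂0 : 0 < r₂ := hr₁0.trans hr₁₂
  -- the two constants
  obtain ⟨C₅, hC₅⟩ := exists_holder_bound_smooth_heat hs hn hμ hμ1 hr₁0 hr₁₂ z.2
  obtain ⟨C₄, hC₄⟩ := mixedNorm_fderiv_pressure_le hs hn1 hr₂0 hr₂R₁ z.2
  refine ⟨C₅ * (1 + C₄), fun u f p G hsol hG hN => ?_⟩
  -- finiteness and integrability of the data on `Q(z,R)`
  have hN' := hN
  simp only [ENNReal.add_lt_top] at hN'
  obtain ⟨⟨⟨hf_fin, hu_fin⟩, hG_fin⟩, hp_fin⟩ := hN'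
  set Q : Opens (ℝ × EuclideanSpace ℝ (Fin 3)) := parabolicCylinderOpens R z with hQdef
  have hu_int : IntegrableOn (uncurry u) (parabolicCylinder R z) volume :=
    integrableOn_parabolicCylinder_of_mixedNorm_lt_top hs hn z hR hsol.1.aestronglyMeasurable hu_fin
  have hp_int : IntegrableOn (uncurry p) (parabolicCylinder R z) volume :=
    integrableOn_parabolicCylinder_of_mixedNorm_lt_top hs hn z hR hsol.2.1.aestronglyMeasurable
      hp_fin
  have hf_int : IntegrableOn (uncurry f) (parabolicCylinder R z) volume :=
    integrableOn_parabolicCylinder_of_mixedNorm_lt_top hs hn z hR hsol.2.2.1.aestronglyMeasurable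
      hf_fin
  have hG_int : IntegrableOn (uncurry G) (parabolicCylinder R z) volume :=
    integrableOn_parabolicCylinder_of_mixedNorm_lt_top hs hn z hR
      hG.locallyIntegrableOn_grad.aestronglyMeasurable hG_fin
  have huE : LocallyIntegrable (zeroExt Q u) volume := locallyIntegrable_zeroExt hu_int
  -- the mollifier sequence
  obtain ⟨φ, hφ0, hφ2⟩ := exists_contDiffBump_seq (E := ℝ × EuclideanSpace ℝ (Fin 3))
  set uj : ℕ → ℝ × EuclideanSpace ℝ (Fin 3) → EuclideanSpace ℝ (Fin 3) := fun j =>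
    uncurry (stMollify ((φ j).normed volume) (zeroExt Q u)) with huj
  -- the uniform bound, eventually
  have hsmall : ∀ᶠ j in atTop, 2 * (φ j).rOut ≤ R ^ 2 - R₁ ^ 2 ∧ (φ j).rOut ≤ R - R₁ := by
    have h1 : 0 < (R ^ 2 - R₁ ^ 2) / 2 := by nlinarith
    have h2 : 0 < R - R₁ := by linarith
    filter_upwards [hφ0.eventually (gt_mem_nhds h1), hφ0.eventually (gt_mem_nhds h2)] with j hj1 hj2
    exact ⟨by linarith, hj2.le⟩
  have hbound : ∀ᶠ j in atTop,
      ∀ za ∈ parabolicCylinder r₁ ((z.1 - (φ j).rOut, z.2) : ℝ × EuclideanSpace ℝ (Fin 3)),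
        ∀ zb ∈ parabolicCylinder r₁ ((z.1 - (φ j).rOut, z.2) : ℝ × EuclideanSpace ℝ (Fin 3)),
          edist (uj j za) (uj j zb) ≤ ((C₅ * (1 + C₄) : ℝ≥0) : ℝ≥0∞) *
              (mixedNorm s n z R (uncurry f) + mixedNorm s n z R (uncurry u) +
                mixedNorm s n z R (uncurry G) + mixedNorm s n z R (uncurry p)) *
            ENNReal.ofReal ((dist za.2 zb.2 + |za.1 - zb.1| ^ (1 / 2 : ℝ)) ^
              (2 - 2 / n - 3 / s)) := by
    filter_upwards [hsmall] with j hj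
    exact mollified_holder_bound hs hn hr₂0 hr₂R₁ z hC₅ hC₄ hsol hG hu_int hp_int hf_int
      hG_int hN (φ j) hj.1 hj.2
  ------------------------------------------------------------------
  -- the limit
  ------------------------------------------------------------------
  -- a.e. convergence of the regularised velocity to `𝟙_Q u`
  have hae : ∀ᵐ w ∂(volume : Measure (ℝ × EuclideanSpace ℝ (Fin 3))),
      Tendsto (fun j => uj j w) atTop (𝓝 (zeroExt Q u w)) := by
    have h := ContDiffBump.ae_convolution_tendsto_right_of_locallyIntegrable
      (μ := (volume : Measure (ℝ × EuclideanSpace ℝ (Fin 3)))) hφ0 (Eventually.of_forall hφ2) huE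
    filter_upwards [h] with w hw
    simpa only [huj, uncurry_stMollify] using hw
  -- the real constant
  set Cℝ : ℝ := ((((C₅ * (1 + C₄) : ℝ≥0) : ℝ≥0∞) *
    (mixedNorm s n z R (uncurry f) + mixedNorm s n z R (uncurry u) +
      mixedNorm s n z R (uncurry G) + mixedNorm s n z R (uncurry p))).toReal) with hCℝ
  have hCtop : (((C₅ * (1 + C₄) : ℝ≥0) : ℝ≥0∞) *
      (mixedNorm s n z R (uncurry f) + mixedNorm s n z R (uncurry u) +
        mixedNorm s n z R (uncurry G) + mixedNorm s n z R (uncurry p))) ≠ ⊤ :=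
    ENNReal.mul_ne_top ENNReal.coe_ne_top hN.ne
  have hCℝ0 : 0 ≤ Cℝ := ENNReal.toReal_nonneg
  -- eventually, points of `Q(z,r)` lie in `Q(z_j, r₁)`
  have hpt : ∀ w ∈ parabolicCylinder r z, ∀ᶠ j in atTop,
      w ∈ parabolicCylinder r₁ ((z.1 - (φ j).rOut, z.2) : ℝ × EuclideanSpace ℝ (Fin 3)) := by
    intro w hw
    rw [mem_parabolicCylinder] at hw
    have h1 : 0 < z.1 - w.1 := by linarith [hw.1.2]
    have h2 : 0 < r₁ ^ 2 - r ^ 2 := by nlinarith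
    filter_upwards [hφ0.eventually (gt_mem_nhds h1), hφ0.eventually (gt_mem_nhds h2)] with j hj1 hj2
    rw [mem_parabolicCylinder]
    dsimp only
    exact ⟨⟨by linarith [hw.1.1, (φ j).rOut_pos], by linarith⟩, lt_trans hw.2 hrr₁⟩
  have hHreal : ∀ za ∈ parabolicCylinder r z, ∀ zb ∈ parabolicCylinder r z, ∀ᶠ j in atTop,
      ‖uj j za - uj j zb‖ ≤ Cℝ * parabolicDist za zb ^ (2 - 2 / n - 3 / s) := by
    intro za hza zb hzb
    filter_upwards [hbound, hpt za hza, hpt zb hzb] with j hj hja hjb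
    have h := hj za hja zb hjb
    have hpd : parabolicDist za zb = dist za.2 zb.2 + |za.1 - zb.1| ^ (1 / 2 : ℝ) := by
      rw [parabolicDist, Real.sqrt_eq_rpow, dist_eq_norm, add_comm]
    rw [edist_dist, dist_eq_norm, ← hpd, ← ENNReal.ofReal_toReal hCtop, ← hCℝ,
      ← ENNReal.ofReal_mul hCℝ0] at h
    exact (ENNReal.ofReal_le_ofReal_iff
      (mul_nonneg hCℝ0 (Real.rpow_nonneg (parabolicDist_nonneg _ _) _))).1 h
  obtain ⟨V, hVae, hVH⟩ := exists_holder_limit_of_ae_tendsto (isOpen_parabolicCylinder r z) hae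
    hCℝ0 hμ hHreal
  have hrsub : parabolicCylinder r z ⊆ parabolicCylinder R z :=
    prod_mono (Ioo_subset_Ioo_left (by nlinarith)) (ball_subset_ball hrR.le)
  refine ⟨V, ?_, fun za hza zb hzb => ?_⟩
  · rw [Filter.EventuallyEq, ae_restrict_iff' (isOpen_parabolicCylinder r z).measurableSet]
    filter_upwards [hVae] with w hw hwr
    rw [hw hwr, zeroExt_of_mem u (show w ∈ ((Q : Opens _) : Set _) from hrsub hwr)]
    rfl
  · have h := hVH za hza zb hzb
    have hpd : parabolicDist za zb = dist za.2 zb.2 + |za.1 - zb.1| ^ (1 / 2 : ℝ) := by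
      rw [parabolicDist, Real.sqrt_eq_rpow, dist_eq_norm, add_comm]
    rw [edist_dist, dist_eq_norm, ← hpd]
    calc ENNReal.ofReal ‖V za - V zb‖
        ≤ ENNReal.ofReal (Cℝ * parabolicDist za zb ^ (2 - 2 / n - 3 / s)) :=
          ENNReal.ofReal_le_ofReal h
      _ = ((C₅ * (1 + C₄) : ℝ≥0) : ℝ≥0∞) *
            (mixedNorm s n z R (uncurry f) + mixedNorm s n z R (uncurry u) +
              mixedNorm s n z R (uncurry G) + mixedNorm s n z R (uncurry p)) *
          ENNReal.ofReal (parabolicDist za zb ^ (2 - 2 / n - 3 / s)) := by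
          rw [ENNReal.ofReal_mul hCℝ0, hCℝ, ENNReal.ofReal_toReal hCtop]

end Main

end Literature.Analysis.FluidPDE

end
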